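import Mathlib
import HarnessLib

/-!
# The Dombre–Gilson front exponent of the Katz–Pavlović chain versus the sub-Onsager shell barrier
# (helper file for the crux `SubOnsagerCeiling.ForwardTailCeilingKP`, stmt-NavierStokesRegularity-27057, `--supports`)

The registered stubs `stub_primaryGradedLargeRatio` / `stub_primaryGradedSmallRatio` of the LEAD skeleton
`Cruxes/ForwardTailCeilingKP/Lines/kp_shell_barrier.lean` contain the ν-uniform θ-shell barrier (`1/2 < θ`) for the positive
Katz–Pavlović / Desnyansky–Novikov chain `a_k' = λ^{k-1} a_{k-1}² − λ^k a_k a_{k+1} − ν b^{2k} a_k`, `λ = b^{5/2}`, at EVERY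
scale ratio `b = 1+ε₀ ∈ (1, 2]`.  Along the true trajectory the per-shell peaks `m_n := sup_t a_n(t)` are governed by the
Dombre–Gilson renormalised travelling front (self-similar blow-up `a_n(t) ≈ c λ^{-(1-y)n} U(c λ^{yn}(t − t_c))`, exponent
`y = y(b)`; [cite: DombreGilson1998, §3] [cite: Mailybaev2013Bifurcations, Thm. 2]): `m_n · b^{(5/2)(1-y) n} → L ∈ (0, ∞)`.
This file records, as pure real analysis on an abstract non-negative sequence `m`, the DICTIONARY between the front
exponent and the barrier that every front-renormalisation attack (repair census R1b/R1c of hands leafhand-4-g0/g1/g2) uses: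

* `kpFront_barrier_of_exponent_lt` — if the peaks converge in the DG scaling with exponent `y < 4/5`, the weighted barrier
  `b^{2θn} · ½ m_n² ≤ D` holds for `θ = (5/2)(1 − y) > 1/2` and some `D ≥ 0`;
* `kpFront_noBarrier_of_exponent_ge` — if they converge with exponent `y ≥ 4/5` (and `L > 0`), NO `θ > 1/2` barrier holds:
  `b^{2θn} · ½ m_n²` is unbounded for every `θ > 1/2` (the kill line of the crux in DG currency);
* `kpFront_exponent_dictionary` — `θ = (5/2)(1 − y)`: `θ > 1/2 ↔ y < 4/5`, and the Kolmogorov value `θ = 5/6 ↔ y = 2/3`.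

Measured (this hand, pure-python DG integration, reproducing hand 4-g0's direct θ_eff table to 3 digits where the front binds):
`y(2) = 0.380, y(1.5) = 0.549, y(1.36) = 0.623, y(1.3) = 0.658, y(1.25) = 0.688, y(1.2) = 0.718, y(1.15) = 0.744,
y(1.1) = 0.759, y(1.08) = 0.757, y(1.06) = 0.744, y(1.04) ≈ 0.71` — maximum ≈ 0.76 < 4/5 near `b ≈ 1.1` (margin 0.04 in `y`,
0.10 in `θ`); `y` crosses `2/3` at `b ≈ 1.28`, above which the post-blow-up Kolmogorov state (`θ = 5/6`) binds instead.

HONEST FRAMING: bookkeeping about a MODEL lattice ODE (route SubOnsagerCeiling, rung TL-M2Break); no stub, crux or summit is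
proved here and nothing in this file bears on Navier–Stokes regularity.
-/

noncomputable section

-- the sub-problem namespace `NavierStokesRegularity.NavierStokesRegularity` is the tree's layout (D-0017)
set_option linter.dupNamespace false

namespace Summit.NavierStokesRegularity.NavierStokesRegularity.Theorems

open Filter Topology

/-- **The exponent dictionary.** With `θ = (5/2)(1 − y)` (DG front exponent `y` of the chain at `λ = b^{5/2}` ↦ decay
exponent `θ` of the per-shell peaks in the scale ratio `b`): the barrier is super-critical (`θ > 1/2`) iff `y < 4/5`, and
`θ` is the Kolmogorov value `5/6` iff `y = 2/3`. [cite: DombreGilson1998, §3] -/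
theorem kpFront_exponent_dictionary (y : ℝ) :
    ((1 : ℝ) / 2 < 5 / 2 * (1 - y) ↔ y < 4 / 5) ∧ ((5 : ℝ) / 2 * (1 - y) = 5 / 6 ↔ y = 2 / 3) := by
  refine ⟨⟨fun h => by linarith, fun h => by linarith⟩, ⟨fun h => by linarith, fun h => by linarith⟩⟩

/-- **Front exponent below the kill line ⇒ barrier.** If the per-shell peaks `m_n ≥ 0` of a chain trajectory converge in
the Dombre–Gilson scaling, `m_n · b^{(5/2)(1-y)n} → L`, with `y < 4/5`, then the weighted shell barrier holds with
`θ = (5/2)(1 − y) > 1/2`: `b^{2θn} · ½ m_n² ≤ D` for all `n`, for some `D ≥ 0` (a convergent sequence is bounded).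
[cite: DombreGilson1998, §3] [cite: Mailybaev2013Bifurcations, Thm. 2] -/
theorem kpFront_barrier_of_exponent_lt {b y L : ℝ} (hb : 1 < b) (hy : y < 4 / 5) {m : ℕ → ℝ}
    (hm : ∀ n, 0 ≤ m n)
    (hconv : Tendsto (fun n : ℕ => m n * b ^ ((5 : ℝ) / 2 * (1 - y) * (n : ℝ))) atTop (𝓝 L)) :
    ∃ θ : ℝ, 1 / 2 < θ ∧ ∃ D : ℝ, 0 ≤ D ∧
      ∀ n : ℕ, b ^ (2 * θ * (n : ℝ)) * ((1 / 2 : ℝ) * m n ^ 2) ≤ D := by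
  have hb0 : (0 : ℝ) ≤ b := by linarith
  obtain ⟨B, hB⟩ := hconv.bddAbove_range
  have hBn : ∀ n : ℕ, m n * b ^ ((5 : ℝ) / 2 * (1 - y) * (n : ℝ)) ≤ B := fun n => hB ⟨n, rfl⟩
  have hB0 : 0 ≤ B := le_trans (mul_nonneg (hm 0) (Real.rpow_nonneg hb0 _)) (hBn 0)
  refine ⟨5 / 2 * (1 - y), by linarith, (1 / 2 : ℝ) * B ^ 2, by positivity, fun n => ?_⟩
  have hsq : b ^ (2 * (5 / 2 * (1 - y)) * (n : ℝ)) = (b ^ ((5 : ℝ) / 2 * (1 - y) * (n : ℝ))) ^ 2 := by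
    rw [← Real.rpow_natCast, ← Real.rpow_mul hb0]
    congr 1; push_cast; ring
  have hc0 : 0 ≤ m n * b ^ ((5 : ℝ) / 2 * (1 - y) * (n : ℝ)) := mul_nonneg (hm n) (Real.rpow_nonneg hb0 _)
  have hp : (m n * b ^ ((5 : ℝ) / 2 * (1 - y) * (n : ℝ))) ^ 2 ≤ B ^ 2 := pow_le_pow_left₀ hc0 (hBn n) 2
  calc b ^ (2 * (5 / 2 * (1 - y)) * (n : ℝ)) * ((1 / 2 : ℝ) * m n ^ 2)
      = (1 / 2 : ℝ) * (m n * b ^ ((5 : ℝ) / 2 * (1 - y) * (n : ℝ))) ^ 2 := by rw [hsq]; ring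
    _ ≤ (1 / 2 : ℝ) * B ^ 2 := by linarith

/-- **Front exponent at or above the kill line ⇒ no super-critical barrier.** If the per-shell peaks converge in the DG
scaling with exponent `y ≥ 4/5` and a POSITIVE limit `L`, then for every `θ > 1/2` the weighted peaks `b^{2θn} · ½ m_n²` are
unbounded: `b^{2θn}·½m_n² = ½ (m_n b^{(5/2)(1-y)n})² · b^{(2θ − 5(1−y))n}` with `2θ − 5(1−y) ≥ 2θ − 1 > 0`.
This is the crux's kill line `W(ε₀) → 1` written in the front-exponent currency. [cite: DombreGilson1998, §3] -/
theorem kpFront_noBarrier_of_exponent_ge {b y L : ℝ} (hb : 1 < b) (hy : 4 / 5 ≤ y) (hL : 0 < L) {m : ℕ → ℝ}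
    (hconv : Tendsto (fun n : ℕ => m n * b ^ ((5 : ℝ) / 2 * (1 - y) * (n : ℝ))) atTop (𝓝 L)) :
    ∀ θ : ℝ, 1 / 2 < θ → ∀ D : ℝ, ∃ n : ℕ, D < b ^ (2 * θ * (n : ℝ)) * ((1 / 2 : ℝ) * m n ^ 2) := by
  intro θ hθ D
  have hb0 : (0 : ℝ) < b := by linarith
  set κ : ℝ := 2 * θ - 5 * (1 - y) with hκ
  have hκ0 : 0 < κ := by rw [hκ]; linarith
  have hbκ : 1 < b ^ κ := Real.one_lt_rpow hb hκ0
  -- eventually the DG-normalised peak is ≥ L/2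
  have h1 : ∀ᶠ n : ℕ in atTop, L / 2 ≤ m n * b ^ ((5 : ℝ) / 2 * (1 - y) * (n : ℝ)) :=
    hconv.eventually_const_le (by linarith)
  -- eventually the excess weight is large
  have h2 : ∀ᶠ n : ℕ in atTop, 8 * D / L ^ 2 + 1 ≤ (b ^ κ) ^ n :=
    (tendsto_pow_atTop_atTop_of_one_lt hbκ).eventually_ge_atTop _
  obtain ⟨n, hn1, hn2⟩ := (h1.and h2).exists
  refine ⟨n, ?_⟩
  have hsplit : b ^ (2 * θ * (n : ℝ)) =
      (b ^ ((5 : ℝ) / 2 * (1 - y) * (n : ℝ))) ^ 2 * (b ^ κ) ^ n := by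
    rw [← Real.rpow_natCast (b ^ ((5 : ℝ) / 2 * (1 - y) * (n : ℝ))), ← Real.rpow_mul hb0.le,
      ← Real.rpow_natCast (b ^ κ), ← Real.rpow_mul hb0.le, ← Real.rpow_add hb0]
    congr 1; rw [hκ]; push_cast; ring
  have hL2 : 0 < L ^ 2 := by positivity
  have hc : (L / 2) ^ 2 ≤ (m n * b ^ ((5 : ℝ) / 2 * (1 - y) * (n : ℝ))) ^ 2 :=
    pow_le_pow_left₀ (by linarith) hn1 2
  have hpow0 : 0 ≤ (b ^ κ) ^ n := pow_nonneg (Real.rpow_nonneg hb0.le κ) n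
  calc D < L ^ 2 / 8 * (8 * D / L ^ 2 + 1) := by
          have : L ^ 2 / 8 * (8 * D / L ^ 2 + 1) = D + L ^ 2 / 8 := by field_simp
          rw [this]; linarith
    _ ≤ L ^ 2 / 8 * (b ^ κ) ^ n := mul_le_mul_of_nonneg_left hn2 (by positivity)
    _ = (1 / 2 : ℝ) * (L / 2) ^ 2 * (b ^ κ) ^ n := by ring
    _ ≤ (1 / 2 : ℝ) * (m n * b ^ ((5 : ℝ) / 2 * (1 - y) * (n : ℝ))) ^ 2 * (b ^ κ) ^ n :=
        mul_le_mul_of_nonneg_right (mul_le_mul_of_nonneg_left hc (by norm_num)) hpow0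
    _ = b ^ (2 * θ * (n : ℝ)) * ((1 / 2 : ℝ) * m n ^ 2) := by rw [hsplit]; ring

end Summit.NavierStokesRegularity.NavierStokesRegularity.Theorems
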